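import Mathlib
import Literature.Computability.AlgebraicComplexity.ArithCircuit
import Literature.Computability.AlgebraicComplexity.StandardFamilies
import Summits.ValiantsHypothesis.ValiantsHypothesis.Theses.DivisionGap

/-!
# Sketch — crux-ideate `stmt-ValiantsHypothesis-5065` (PerDivisionHard), ideator 1, round 1

First lemmas of the two idea cards, stated over existing declarations (no proofs required at
this stage; `sorry` allowed).  Card 1 = `pair-descent-jss-endpoint`, Card 2 = `all-ones-jets`.
-/

noncomputable section

set_option linter.dupNamespace false

open MvPolynomial
open scoped NNReal BigOperators

namespace Summit.ValiantsHypothesis.ValiantsHypothesis.Cruxes.PerDivisionHard.IdeatorOne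

open Literature.Computability.AlgebraicComplexity
open Summit.ValiantsHypothesis.ValiantsHypothesis.Theses.DivisionGap (PerDivisionHard)

variable {σ : Type} [Fintype σ] [DecidableEq σ]

/-! ## Card 1 — Birkhoff face descent -/

/-- The TOP weighted-homogeneous component of `f` for a weight `w : σ → ℕ` (the initial form of
`f` on the face of its Newton polytope maximising `w`). -/
def topPart (w : σ → ℕ) (f : MvPolynomial σ ℝ≥0) : MvPolynomial σ ℝ≥0 :=
  weightedHomogeneousComponent w (weightedTotalDegree w f) f

/-- **First lemma of Card 1 (initial forms are free for monotone circuits).**  Over `ℝ≥0` no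
cancellation occurs, so replacing every gate of a fan-in-two circuit by its top `w`-component
(dropping the lighter operand of a sum gate, keeping both operands of a product gate) computes
the top `w`-component of the output with the same number of gates: Jerrum–Snir 1982 Thm 2.4 /
Jukna 2023 Lemma 1.32 ("envelopes") for an arbitrary weight instead of total degree. -/
def InitialFormMonotone : Prop :=
  ∀ (σ : Type) [Fintype σ] [DecidableEq σ] (w : σ → ℕ) (f : MvPolynomial σ ℝ≥0),
    complexity (weightedHomogeneousComponent w (weightedTotalDegree w f) f) ≤ complexity f

theorem initialFormMonotone : InitialFormMonotone := by
  sorry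

/-- Row weight `𝟙[row = i]` and column weight `𝟙[col = j]` on the entries of an `n × n` matrix:
the characters of the torus `(ℝ_{>0})ⁿ × (ℝ_{>0})ⁿ` acting by `x ↦ D₁ x D₂`. -/
def rowWeight {n : ℕ} (i : Fin n) : Fin n × Fin n → ℕ := fun e => if e.1 = i then 1 else 0
/-- Column weight. -/
def colWeight {n : ℕ} (j : Fin n) : Fin n × Fin n → ℕ := fun e => if e.2 = j then 1 else 0

/-- `h` is multihomogeneous for the row/column torus: all its monomials have the same row sums
and the same column sums (it lies in one isotypic component of the torus action). -/
def IsTorusHomogeneous {n : ℕ} (h : MvPolynomial (Fin n × Fin n) ℝ≥0) : Prop :=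
  (∀ i : Fin n, ∃ d : ℕ, IsWeightedHomogeneous (rowWeight i) h d) ∧
    (∀ j : Fin n, ∃ d : ℕ, IsWeightedHomogeneous (colWeight j) h d)

/-- The crux restricted to torus-homogeneous multipliers. -/
def PerDivisionHardTorus : Prop :=
  ∀ c : ℕ, ∃ n₀ : ℕ, ∀ n ≥ n₀, ∀ h : MvPolynomial (Fin n × Fin n) ℝ≥0, h ≠ 0 →
    IsTorusHomogeneous h →
      2 ^ ((Nat.log 2 n + c) ^ c) <
        complexity (perPoly (Fin n) ℝ≥0 * h) + complexity h

/-- **Torus reduction (Card 1, step 0).**  Since `per_n` is weighted-homogeneous of weight `1`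
for every row and column weight, `top_w (per · h) = per · top_w h`; iterating over the `2n`
weights and using `InitialFormMonotone` replaces any `h ≠ 0` by a torus-homogeneous `h' ≠ 0`
with `L(per·h') + L(h') ≤ L(per·h) + L(h)`.  Hence the crux reduces to torus-homogeneous `h`. -/
theorem perDivisionHard_of_torus (hI : InitialFormMonotone) :
    PerDivisionHardTorus → PerDivisionHard := by
  sorry

/-- The permanent of a bipartite graph `G ⊆ [n] × [n]` (edge set as a `Finset`): the face of
the Birkhoff polytope spanned by the perfect matchings of `G`. -/
def perOfGraph {n : ℕ} (G : Finset (Fin n × Fin n)) : MvPolynomial (Fin n × Fin n) ℝ≥0 :=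
  ∑ ρ ∈ (Finset.univ : Finset (Equiv.Perm (Fin n))).filter (fun ρ => ∀ j, (ρ j, j) ∈ G),
    ∏ j : Fin n, X (ρ j, j)

/-- **Face descent (Card 1, the lever).**  For a weight `λ = (torus part) + p` with `p > 0`
exactly off `G` (a relatively open normal vector of the face `F_G` of the Birkhoff polytope),
`in_λ(per) = per(G)` and `in_λ(h)` = the `p`-bottom fibre of `h`; if that fibre has a single
`G`-part `u`, substituting `1` off `G` leaves the pair `(per(G) · x^u, x^u)`.  Rendered as the
inequality the prover needs (existence of the good face is the combinatorial crux K2):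
for torus-homogeneous `h ≠ 0`, every graph `G` with a perfect matching and every monomial `u`
which is the unique `G`-part of the bottom fibre of `h` for some positive weight off `G`,
`L(per(G) · x^u) ≤ L(per · h) + (number of variables)` (substitution gates). -/
def FaceDescent : Prop :=
  ∀ (n : ℕ) (h : MvPolynomial (Fin n × Fin n) ℝ≥0) (G : Finset (Fin n × Fin n))
    (p : Fin n × Fin n → ℕ) (u : (Fin n × Fin n) →₀ ℕ),
    h ≠ 0 → IsTorusHomogeneous h → (∀ e, p e = 0 ↔ e ∈ G) →
    (∃ ρ : Equiv.Perm (Fin n), ∀ j, (ρ j, j) ∈ G) →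
    -- `u` is the common restriction to `G` of all monomials of `h` of minimal `p`-weight
    (∀ m ∈ h.support, (Finsupp.weight p m = ⨅ m' ∈ h.support, Finsupp.weight p m') →
        ∀ e ∈ G, m e = u e) →
    (∀ e ∉ G, u e = 0) →
      complexity (perOfGraph G * monomial u (1 : ℝ≥0)) ≤
        complexity (perPoly (Fin n) ℝ≥0 * h) + n * n + 1

theorem faceDescent (hI : InitialFormMonotone) : FaceDescent := by
  sorry

/-- **Endpoint (Card 1, K1): monomial multiples of hard faces are hard.**  Jukna–Seiwert–Sergeev
(Jukna 2023 Rem. 6.19: reciprocal inputs cost at most `O(N s²)`) + Jerrum–Snir on a `b × b`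
block: for the graph `G(b,k)` = `K_{b,b}` with every edge subdivided by `2k` vertices, padded by
a perfect matching, `L(per(G) · x^u) ≥ 2^{b/2} / poly(n)` for every monomial `u`.  Stated in the
weak form the assembly needs. -/
def MonomialMultipleOfBlockHard : Prop :=
  ∃ C : ℕ, ∀ (n b : ℕ) (G : Finset (Fin n × Fin n)) (u : (Fin n × Fin n) →₀ ℕ),
    -- `G` contains, as an induced pattern on some `b` rows `R` and `b` columns `S`, the complete
    -- bipartite graph, and every perfect matching of `G` restricts to a bijection `R → S`
    (∃ (R S : Finset (Fin n)), R.card = b ∧ S.card = b ∧ (∀ i ∈ R, ∀ j ∈ S, (i, j) ∈ G) ∧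
      ∀ ρ : Equiv.Perm (Fin n), (∀ j, (ρ j, j) ∈ G) → ∀ j, (j ∈ S ↔ ρ j ∈ R)) →
    2 ^ (b / 2) ≤ (n + 2) ^ C * (complexity (perOfGraph G * monomial u (1 : ℝ≥0)) + 1) ^ 2

/-! ## Card 2 — jets at the all-ones point -/

/-- The shift `x_e ↦ 1 + y_e` (a positive, hence monotone, substitution). -/
def shiftOnes (f : MvPolynomial σ ℝ≥0) : MvPolynomial σ ℝ≥0 :=
  bind₁ (fun e => X e + 1) f

/-- The degree-`k` jet of the pair at the all-ones point:
`E_k(h) = [y^k] per(𝟙 + y) · h(𝟙 + y) = Σ_{i ≤ k} (n-i)! · σ_i(y) · h_{k-i}(y)`,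
`σ_i` = sum of all `i × i` subpermanents, `h_j = [y^j] h(𝟙 + y)` the `j`-th binomial moment. -/
def jet {n : ℕ} (k : ℕ) (h : MvPolynomial (Fin n × Fin n) ℝ≥0) :
    MvPolynomial (Fin n × Fin n) ℝ≥0 :=
  homogeneousComponent k (shiftOnes (perPoly (Fin n) ℝ≥0 * h))

/-- **First lemma of Card 2 (jets are monotone-cheap and degree-free).**  Shifting costs one
gate per variable and extracting the homogeneous component of degree `k` of a monotone circuit
costs a factor `O((k+1)²)` (keep the components of degree `≤ k` at every gate; monotone since
no subtraction is involved) — independently of `deg h`, which may be exponential in the size. -/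
def JetCheap : Prop :=
  ∃ C : ℕ, ∀ (n k : ℕ) (h : MvPolynomial (Fin n × Fin n) ℝ≥0),
    complexity (jet k h) ≤ C * (k + 1) ^ 2 * (complexity (perPoly (Fin n) ℝ≥0 * h) + n * n + 1)

theorem jetCheap : JetCheap := by
  sorry

/-- **The additive normal form (Card 2).**  Every `k`-partial-permutation monomial `π`
(`k` ones, no two in a row or column) occurs in `E_k(h)` with coefficient at least
`(n-k)! · h(𝟙)`, and `h(𝟙) > 0` for `h ≠ 0`: the hard polynomial `σ_k` sits inside the jet
ADDITIVELY, the multiplier contributing only the background `Σ_{j ≥ 1} (n-k+j)! σ_{k-j} h_j`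
governed by the first `k` binomial moments of `h`. -/
def JetContainsSubpermanents : Prop :=
  ∀ (n k : ℕ) (h : MvPolynomial (Fin n × Fin n) ℝ≥0) (R S : Finset (Fin n)) (e : R ≃ S),
    R.card = k →
      ((n - k).factorial : ℝ≥0) * eval (fun _ => (1 : ℝ≥0)) h ≤
        coeff (∑ i : R, Finsupp.single ((i : Fin n), ((e i : S) : Fin n)) 1) (jet k h)

theorem jetContainsSubpermanents : JetContainsSubpermanents := by
  sorry

/-- **Transfer target of Card 2 (C⁺, ε-insensitivity of subpermanent sums under moment
ceilings).**  With `k = n/2`: every monotone circuit computing a polynomial `T` sandwiched as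
`(n-k)!·σ_k ≤ T ≤ (n-k)!·σ_k + B` coefficientwise, where the ceiling `B` is a nonnegative
combination `Σ_{1 ≤ j ≤ k} (n-k+j)!/(k-j)! · p₁^{k-j} · m_j` with `p₁ = Σ_e y_e` and `m_j` the
binomial moments of SOME nonzero `h ∈ ℝ≥0[x]` of monotone complexity `≤ s`, has size
`> 2^{(log n + c)^c}` unless `s` does.  (Informal; the card explains why this is an
`ε`-sensitive lower bound for `σ_k` at rate `ε ≈ 2^{-k·log(deg h)}` and which printed partial
results apply.)  Recorded here only as the shape of the implication the line would prove. -/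
def JetTransfer : Prop :=
  JetCheap ∧ JetContainsSubpermanents →
    (∀ c : ℕ, ∃ n₀ : ℕ, ∀ n ≥ n₀, ∀ h : MvPolynomial (Fin n × Fin n) ℝ≥0, h ≠ 0 →
      2 ^ ((Nat.log 2 n + c) ^ c) < complexity (jet (n / 2) h) + complexity h) →
    PerDivisionHard


/-! ## Card 3 — twisted-diagonal recursion (the power core) -/

/-- The `α`-twisted diagonal along `σ`: the table with the single entry `α i` in row `i`, at
column `σ i` (for `α = v·𝟙` this is `v · P_σ`, a vertex of `v · B_n`). -/
def twisted {n : ℕ} (α : Fin n → ℕ) (σ : Equiv.Perm (Fin n)) : (Fin n × Fin n) →₀ ℕ :=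
  ∑ i : Fin n, Finsupp.single (i, σ i) (α i)

/-- Column sums of an exponent table. -/
def colSum {n : ℕ} (m : (Fin n × Fin n) →₀ ℕ) (j : Fin n) : ℕ := ∑ i : Fin n, m (i, j)

/-- **First lemma of Card 3 (coset rigidity of vertex production).**  Over `ℝ≥0`, if `a · b`
has all its monomials in ONE column-sum class (as it must when `a · b ≤ g` coefficientwise for a
torus-homogeneous `g`, e.g. `g = per^v` or `g = per · h` with `h` torus-homogeneous), then the set
of permutations `σ` for which `a ∋ x^{α'∘σ}` and `b ∋ x^{α''∘σ}` is contained in a single coset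
of `Stab(α') ∩ Stab(α'')`: two such permutations differ by a permutation preserving both row
types.  (No cancellation: `coeff (α'∘σ + α''∘τ) (a·b) ≥ coeff (α'∘σ) a · coeff (α''∘τ) b > 0`.) -/
def CosetRigidity : Prop :=
  ∀ (n : ℕ) (a b : MvPolynomial (Fin n × Fin n) ℝ≥0) (α' α'' β : Fin n → ℕ),
    (∀ m ∈ (a * b).support, ∀ j, colSum m j = β j) →
    ∀ σ τ : Equiv.Perm (Fin n),
      twisted α' σ ∈ a.support → twisted α'' σ ∈ b.support →
      twisted α' τ ∈ a.support → twisted α'' τ ∈ b.support →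
        ∀ i : Fin n, α' ((σ⁻¹ * τ) i) = α' i ∧ α'' ((σ⁻¹ * τ) i) = α'' i

theorem cosetRigidity : CosetRigidity := by
  sorry

/-- **Where twisted diagonals come from (Card 3, the production step).**  If `u ≤ α∘σ`
entrywise and `u` has row sums `α'`, then `u = α'∘σ`: a sub-table of a twisted diagonal is the
twisted diagonal of its own row type.  Hence in `a · b ∋ x^{α∘σ}` (no cancellation) the witness
pair is `(α'∘σ, α''∘σ)` with `α' + α'' = α`. -/
def SubtableOfTwisted : Prop :=
  ∀ (n : ℕ) (α α' : Fin n → ℕ) (σ : Equiv.Perm (Fin n)) (u : (Fin n × Fin n) →₀ ℕ),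
    u ≤ twisted α σ → (∀ i, ∑ j : Fin n, u (i, j) = α' i) → u = twisted α' σ

theorem subtableOfTwisted : SubtableOfTwisted := by
  sorry

/-- **Target of Card 3 (the power core of the crux).**  Monotone complexity of powers of the
permanent beyond the Boolean shadow: `L(per_n^v) ≥ 2^{n / (C·(log₂ v + 1))} / (n+2)^C` for all
`n, v ≥ 1` — super-quasi-polynomial as long as `v ≤ 2^{n/(log n)^{ω(1)}}`; the instance
`h = per^{v-1}` of the crux then holds in that range.  (Boolean transfer gives `n^{Ω(log n)}`
uniformly in `v`; the `ℓ¹`/support content bound gives `2^{Ω(n/3^v)}` (useful for `v ≤ log₃ n`) and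
provably nothing for `v ≥ C n log n`.) -/
def PowerHard : Prop :=
  ∃ C : ℕ, 0 < C ∧ ∀ (n v : ℕ), 1 ≤ v →
    2 ^ (n / (C * (Nat.log 2 v + 1))) ≤
      (n + 2) ^ C * complexity (perPoly (Fin n) ℝ≥0 ^ v)

end Summit.ValiantsHypothesis.ValiantsHypothesis.Cruxes.PerDivisionHard.IdeatorOne

end
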